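/-
Copyright (c) 2026 the pub-hodgecm-mathlib formalisation cell (harness21).  Prover seat hodgecm-mathlib-A-p12 (g25): road «S3-ram» (LEAD F0P3a-plan (g13); (Cnt2′) chair
F0P3a-p07 (g15) RULING (22)(c): the shared CM census head of the regime-B hyperbolic cells; (α) keeper F0P3a-p06 (g16)); 2026-09-02.
-/
import Literature.NumberTheory.Rogawski1990.DepthZeroKappaTransferTypeTwoRamifiedHyperbolicTotalsPm      -- ★ p849335 (F0P3a-p08 (g20)): the pm socket head; brings the CM dictionary (★ p849189 etc.)
import Literature.NumberTheory.Rogawski1990.DepthZeroKappaTransferTypeTwoRamifiedHyperbolicRegionCensusClosedForm  -- (K4e) p849795 (this seat): closed-form census, generic `K`; brings (K4c) ★ p849554, (K4b), (K4a)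
import Literature.NumberTheory.Rogawski1990.DepthZeroKappaTransferTypeTwoRamifiedHyperbolicLockBridge    -- ★ p849578 (this seat): (K4d) `lock_iff_of_trace_eq_mul`
import Literature.NumberTheory.Rogawski1990.TypeTwoRamifiedHyperbolicRegionShellKindsOdd                 -- ★ p849605 (F0P3a-p08 (g21)): (K5-B-J) FILE 3; brings FILE 2 ★ p849540, ★ p849388
import Literature.NumberTheory.Automorphic.UnitaryLatticeTreeNilpotencyTokenOfDepths                    -- ★ `map_sub_one_pow_three_le_scaleLattice_of_charpoly_block_antidiagonal` (`hnil3`)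
import Literature.NumberTheory.Automorphic.UnitaryLatticeTreeFramesOfInvolution                          -- ★ `isTree_latticeGraph_three_of_neg`
import HarnessLib

/-!
# The regime-B hyperbolic cells of the (α) block law: THE SHARED CENSUS HEAD `#R, ΣE, ΣP ± ΣM` at the CM place, ODD `N` (parity split, F0P3a-p04 (g21) 06:19:57Z) (Kottwitz 1986 §3; Rogawski 1990 §4.9)

Topic `NumberTheory/Rogawski1990`; namespace `Literature.NumberTheory.Rogawski1990.BlockLawHyp`.  THEOREMS ONLY (no definition, no instance, no notation, no named fact, no
`sorry`); kernel lane `--supports stmt-HodgeConjecture-24833`.  Cell `pub/hodgecm-mathlib` (D-0151), crux H413; road «S3-ram» (count-neutral); (Cnt2′) ROUTE B, chair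
F0P3a-p07 (g15) RULING (22)(c) «= split» (F0P3a-p04 (g21) 05:49:47Z): A-p12 (g25) cuts the SHARED CLOSED-FORM CENSUS of the hyperbolic literal in REGIME B, F0P3a-p04 lands
`stub_Zhyp_pm_{even,odd}_B` and F0P3a-p08 (g21) `stub_Zhyp_zero_{even,odd}_B` over it.  Binders = ★ p849335 `hyperbolicTotal_pm_ram_of_region_census_odd`'s VERBATIM through
`(sR) (hsR)` (without `NE NP NM hNE hNP hNM`), then ★ p849388's `(hblk) {n} (hdisc) (hm) (β) (hβ)` VERBATIM, then `(a) (hna : n = a + mA + 1) (hlt : m < N)`.  Conclusion (in `ℂ`,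
`q = (Ideal.absNorm v.asIdeal : ℂ)`, the three sums = ★ p849335's `hNE hNP hNM` left-hand sides VERBATIM, `Λ(c)` = the keeper's pm text VERBATIM):
* **`hyperbolicRegionCensus_even_B_ram`** (`N = 2n`): `#sR = (q+1)Σ_{i<a} q^i`, `ΣE = (q+1)q^a`, `ΣP + ΣM = (q−1)q·#sR`, `Λ(c) → ΣP − ΣM = −(q+1)q`, `¬Λ(c) → ΣP − ΣM = (q+1)q`;
* **`hyperbolicRegionCensus_odd_B_ram`** (`N = 2n+1`): `#sR = (q+1)Σ_{i<a} q^i + q^a`, `ΣE = 2q^(a+1)`, and the same three `P ± M` clauses.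
PROOF = (K4e) `regionCensus_hyperbolic_closedForm_{even,odd}` (= ★ (K4c) ∘ the layer arithmetic, generic `K`) at `K := L_w`, `γ := γ′`, `B₀ := k⁻¹(s·ĝ_w)k`, `d₀ := m` (binders discharged by the CM
dictionary exactly as in ★ p849335 ∕ ★ p849540: `ramifiedBlock_adicCompletion`, `isTree_latticeGraph_three_of_neg`, `isPrincipalIdealRing_integer_adicCompletion`, `hnil3` by ★
`map_sub_one_pow_three_le_scaleLattice_of_charpoly_block_antidiagonal`, `hcB` by chair ★ `typeTwo_depthDictionary_{even,odd}_ram` clause (B), `hdisc` by ★ `v_disc_rerootedCentred_ram`)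
∘ the kind counts ★ p849540 (`n₀`), ★ p849605 ∕ p849615 (`n₁ = n₂`) of F0P3a-p08 (g21) fed VERBATIM ∘ ★ (K4d) `lock_iff_of_trace_eq_mul` (`Λ(c)` ⟺ the lock at `B₀`); `q ↦ N𝔭_v` by
★ `natCard_residueField_eq_of_ramified` + `Ideal.absNorm_apply`.  HONEST LABEL: HC_CM is proved only modulo the 2
remaining named inputs (hLiu418 24832, h413 24833) until rung 0 closes; nothing printed is asserted here (composition of ★ theorems); «S3-ram» has no books consequence.

## References
* [Kottwitz1986] R. E. Kottwitz, *Base change for unit elements of Hecke algebras*, Compositio Math. 60 (1986), §3.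
* [Rogawski1990] J. D. Rogawski, *Automorphic Representations of Unitary Groups in Three Variables*, Ann. of Math. Stud. 123 (1990), §4.9 pp. 54–56, Prop. 4.9.1, Lemma 4.9.3.
* [LabesseLanglands1979] J.-P. Labesse, R. P. Langlands, *L-indistinguishability for SL(2)*, Canad. J. Math. 31 (1979), §2 Lemma 2.1.
* [BruhatTits1972] F. Bruhat, J. Tits, *Groupes réductifs sur un corps local I*, Publ. Math. IHÉS 41 (1972), §10.
-/

set_option autoImplicit false

noncomputable section

open NumberField IsDedekindDomain Matrix Polynomial ValuativeRel
open Classical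
open Literature.NumberTheory.Automorphic Literature.NumberTheory.Automorphic.UnitaryGroup
open Literature.NumberTheory.Automorphic.UnitaryLatticeTree Literature.NumberTheory.Automorphic.HermitianLattice
open Literature.NumberTheory.GaloisRepresentations
open Literature.NumberTheory.Rogawski1990 Literature.NumberTheory.Rogawski1990.TypeOneRamifiedJunction
open scoped Matrix MatrixGroups ValuativeRel WithZero

namespace Literature.NumberTheory.Rogawski1990.BlockLawHyp

variable (L : Type) [Field L] [NumberField L] [IsCMField L] {v : HeightOneSpectrum (𝓞 ↥(maximalRealSubfield L))}

set_option maxHeartbeats 3200000 in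
-- budget only: statement-heavy CM lattice tokens (★ p849335's binders and sums).
/-- **THE SHARED CENSUS OF THE HYPERBOLIC LITERAL, REGIME B, `N = 2n+1`** (`m = 2mA + 3 < 2n+1`, `n = a + mA + 1`): `#sR = (q+1)Σ_{i<a} q^i + q^a`, `ΣE = 2q^(a+1)`,
`ΣP + ΣM = (q−1)q·#sR`, `Λ(c) → ΣP − ΣM = −(q+1)q`, `¬Λ(c) → ΣP − ΣM = (q+1)q` (`q = N𝔭_v` in `ℂ`).
[cite: Kottwitz1986, §3] [cite: Rogawski1990, §4.9 Prop. 4.9.1 (b) p. 55, Lemma 4.9.3] [cite: LabesseLanglands1979, §2 Lemma 2.1] -/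
theorem hyperbolicRegionCensus_odd_B_ram (w : PlacesOver L v)
    (hw : IsCMField.complexConj L • w.1 = w.1) (he : v.asIdeal.ramificationIdx' w.1.asIdeal ≠ 1)
    (h2 : IsUnit (2 : 𝒪[(w.1.adicCompletion L)]))
    (ϖ : w.1.adicCompletion L) (hϖ : Valued.v ϖ = WithZero.exp (-1 : ℤ)) (hσϖ : galAdicCompletionMap (L := L) (IsCMField.complexConj L) hw ϖ = -ϖ)
    (γH : ((cmDatum L 2 (Matrix.of fun i j : Fin 2 => if i.val + j.val + 1 = 2 then (1 : L) else 0)).Local v ×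
      (cmDatum L 1 (Matrix.of fun i j : Fin 1 => if i.val + j.val + 1 = 1 then (1 : L) else 0)).Local v))
    (hu2 : Valued.v (finGammaTwo L v γH w - 1) ≤ Valued.v (ϖ ^ 2))
    (hirr : ¬ ∃ x : (w.1.adicCompletion L), ((((γH.1.val : GL (Fin 2) (UnitaryGroup.LocalRing L v)).val.map
      (Pi.evalRingHom (fun w' : PlacesOver L v => w'.1.adicCompletion L) w))).charpoly).IsRoot x)
    (m : ℕ) (mA : ℕ) (hmA : m = 2 * mA + 3)
    (s : (w.1.adicCompletion L)ˣ) (hs : (s : w.1.adicCompletion L) * (((localNonsplitEquiv (IsCMField.complexConj L) (Matrix.of fun i j : Fin 1 => if i.val + j.val + 1 = 1 then (1 : L) else 0) (IsCMField.complexConj_ne_one L) w hw γH.2).val : GL (Fin 1) (w.1.adicCompletion L)) : Matrix (Fin 1) (Fin 1) (w.1.adicCompletion L)) 0 0 = 1)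
    (k : GL (Fin 2) (w.1.adicCompletion L))
    (hk : k ∈ unitaryGroupOfForm (galAdicCompletionMap (L := L) (IsCMField.complexConj L) hw)
      (placeForm (Matrix.of fun i j : Fin 2 => if i.val + j.val + 1 = 2 then (1 : L) else 0) w.1))
    (hd : ∀ i j, Valued.v (((((k⁻¹ * (Matrix.GeneralLinearGroup.scalar (Fin 2) s * ((localNonsplitEquiv (IsCMField.complexConj L) (Matrix.of fun i j : Fin 2 => if i.val + j.val + 1 = 2 then (1 : L) else 0) (IsCMField.complexConj_ne_one L) w hw γH.1).val : GL (Fin 2) (w.1.adicCompletion L))) * k) : GL (Fin 2) (w.1.adicCompletion L)) : Matrix (Fin 2) (Fin 2) (w.1.adicCompletion L)) - 1) i j) ≤ Valued.v ϖ ^ m)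
    (γ' : unitaryGroupOfForm (galAdicCompletionMap (L := L) (IsCMField.complexConj L) hw) ((StdForm.antidiagonal 3).over (w.1.adicCompletion L)))
    (hγ' : (γ' : GL (Fin 3) (w.1.adicCompletion L)) = endoGL ((k⁻¹ * (Matrix.GeneralLinearGroup.scalar (Fin 2) s * ((localNonsplitEquiv (IsCMField.complexConj L) (Matrix.of fun i j : Fin 2 => if i.val + j.val + 1 = 2 then (1 : L) else 0) (IsCMField.complexConj_ne_one L) w hw γH.1).val : GL (Fin 2) (w.1.adicCompletion L))) * k), (1 : GL (Fin 1) (w.1.adicCompletion L))))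
    (c ε : w.1.adicCompletion L) (hc : Valued.v c = 1) (hεv : Valued.v ε = 1) (hε : ∀ z : (w.1.adicCompletion L), Valued.v z ≤ 1 → Valued.v (z ^ 2 - ε) = 1)
    (sR : Finset {M : Submodule (Valued.integer (w.1.adicCompletion L)) (Fin 3 → (w.1.adicCompletion L)) // IsVertex (galAdicCompletionMap (L := L) (IsCMField.complexConj L) hw) ϖ ((StdForm.antidiagonal 3).over (w.1.adicCompletion L)) M}) (hsR : ∀ vtx, vtx ∈ sR ↔ vtx ∈ {vtx : {M : Submodule (Valued.integer (w.1.adicCompletion L)) (Fin 3 → (w.1.adicCompletion L)) // IsVertex (galAdicCompletionMap (L := L) (IsCMField.complexConj L) hw) ϖ ((StdForm.antidiagonal 3).over (w.1.adicCompletion L)) M} | latticeGraphIso (galAdicCompletionMap (L := L) (IsCMField.complexConj L) hw) ϖ ((StdForm.antidiagonal 3).over (w.1.adicCompletion L)) γ' vtx = vtx ∧ IsSelfDualLattice (galAdicCompletionMap (L := L) (IsCMField.complexConj L) hw) ϖ ((StdForm.antidiagonal 3).over (w.1.adicCompletion L)) vtx.1 ∧ vtx.1.map ((Matrix.toLin'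 (((γ' : GL (Fin 3) (w.1.adicCompletion L)) : Matrix (Fin 3) (Fin 3) (w.1.adicCompletion L)) - 1)).restrictScalars (Valued.integer (w.1.adicCompletion L))) ≤ scaleLattice (ϖ ^ m) vtx.1})
    (hblk : ∀ i j : Fin 2, Valued.v (((((γH.1.val : GL (Fin 2) (UnitaryGroup.LocalRing L v)).val.map (Pi.evalRingHom (fun w' : PlacesOver L v => w'.1.adicCompletion L) w))) - 1) i j) ≤ Valued.v (ϖ ^ 2))
    {n : ℕ}
    (hdisc : Valued.v ((((γH.1.val : GL (Fin 2) (UnitaryGroup.LocalRing L v)).val.map (Pi.evalRingHom (fun w' : PlacesOver L v => w'.1.adicCompletion L) w))).trace ^ 2 - 4 * (((γH.1.val : GL (Fin 2) (UnitaryGroup.LocalRing L v)).val.map (Pi.evalRingHom (fun w' : PlacesOver L v => w'.1.adicCompletion L) w))).det) = WithZero.exp (-((2 * (2 * n + 1) : ℕ) : ℤ)))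
    (hm : Valued.v (((finCharpolyTwo L v γH).eval (finGammaTwo L v γH)) w) =
      Valued.v ((toPlace v w (HeckeCharacter.uniformizer ↥(maximalRealSubfield L) v : v.adicCompletion ↥(maximalRealSubfield L))) ^ m))
    (β : (v.adicCompletion ↥(maximalRealSubfield L))ˣ)
    (hβ : toPlace v w (β : v.adicCompletion ↥(maximalRealSubfield L)) =
      -(((finCharpolyTwo L v γH).eval (finGammaTwo L v γH)) w *
          (finGammaTwo L v γH w ^ 2 + ((γH.1.val.val : Matrix (Fin 2) (Fin 2) (LocalRing L v)).map (Pi.evalRingHom (fun w' : PlacesOver L v => w'.1.adicCompletion L) w)).det)) /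
        (2 * finGammaTwo L v γH w ^ 2 * ((γH.1.val.val : Matrix (Fin 2) (Fin 2) (LocalRing L v)).map (Pi.evalRingHom (fun w' : PlacesOver L v => w'.1.adicCompletion L) w)).det))
    (a : ℕ) (hna : n = a + mA + 1) (hlt : m < 2 * n + 1) :
    ((sR.card : ℕ) : ℂ) = ((Ideal.absNorm v.asIdeal : ℂ) + 1) * ∑ i ∈ Finset.range a, (Ideal.absNorm v.asIdeal : ℂ) ^ i + (Ideal.absNorm v.asIdeal : ℂ) ^ a ∧
    ((∑ vtx ∈ sR, ({wtx | wtx ∈ {wtx | ∃ cx, ((latticeGraph (galAdicCompletionMap (L := L) (IsCMField.complexConj L) hw) ϖ ((StdForm.antidiagonal 3).over (w.1.adicCompletion L))).Adj vtx cx ∧ (latticeGraph (galAdicCompletionMap (L := L) (IsCMField.complexConj L) hw) ϖ ((StdForm.antidiagonal 3).over (w.1.adicCompletion L))).dist ⟨stdLattice (w.1.adicCompletion L) 3, 0, isSelfDualLattice_stdLattice_three_of_v hϖ⟩ cx = (latticeGraph (galAdicCompletionMap (L := L) (IsCMField.complexConj L) hw) ϖ ((StdForm.antidiagonal 3).over (w.1.adicCompletion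 L))).dist ⟨stdLattice (w.1.adicCompletion L) 3, 0, isSelfDualLattice_stdLattice_three_of_v hϖ⟩ vtx + 1 ∧ latticeGraphIso (galAdicCompletionMap (L := L) (IsCMField.complexConj L) hw) ϖ ((StdForm.antidiagonal 3).over (w.1.adicCompletion L)) γ' cx = cx) ∧ ((latticeGraph (galAdicCompletionMap (L := L) (IsCMField.complexConj L) hw) ϖ ((StdForm.antidiagonal 3).over (w.1.adicCompletion L))).Adj cx wtx ∧ (latticeGraph (galAdicCompletionMap (L := L) (IsCMField.complexConj L) hw) ϖ ((StdForm.antidiagonal 3).over (w.1.adicCompletion L))).dist ⟨stdLattice (w.1.adicCompletion L) 3, 0, isSelfDualLattice_stdLattice_three_of_v hϖ⟩ wtx = (latticeGraph (galAdicCompletionMap (L := L) (IsCMField.complexConj L) hw) ϖ ((StdForm.antidiagonal 3).over (w.1.adicCompletion L))).dist ⟨stdLattice (w.1.adicCompletion L) 3, 0, isSelfDualLattice_stdLattice_three_of_v hϖ⟩ cx + 1 ∧ latticeGraphIso (galAdicCompletionMap (L := L) (IsCMField.complexConj L) hw) ϖ ((StdForm.antidiagonal 3).over (w.1.adicCompletion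 L)) γ' wtx = wtx)} ∧ (¬ wtx.1.map ((Matrix.toLin' (((γ' : GL (Fin 3) (w.1.adicCompletion L)) : Matrix (Fin 3) (Fin 3) (w.1.adicCompletion L)) - 1)).restrictScalars (Valued.integer (w.1.adicCompletion L))) ≤ scaleLattice (ϖ ^ m) wtx.1 ∧ (wtx.1.map ((Matrix.toLin' (((γ' : GL (Fin 3) (w.1.adicCompletion L)) : Matrix (Fin 3) (Fin 3) (w.1.adicCompletion L)) - 1)).restrictScalars (Valued.integer (w.1.adicCompletion L))) ≤ scaleLattice (ϖ ^ (m - 1)) wtx.1 ∧ ¬ wtx.1.map ((Matrix.toLin' (((γ' : GL (Fin 3) (w.1.adicCompletion L)) : Matrix (Fin 3) (Fin 3) (w.1.adicCompletion L)) - 1)).restrictScalars (Valued.integer (w.1.adicCompletion L))) ≤ scaleLattice (ϖ ^ m) wtx.1))}).ncard : ℕ) : ℂ) = 2 * (Ideal.absNorm v.asIdeal : ℂ) ^ (a + 1) ∧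
    ((∑ vtx ∈ sR, ({wtx | wtx ∈ {wtx | ∃ cx, ((latticeGraph (galAdicCompletionMap (L := L) (IsCMField.complexConj L) hw) ϖ ((StdForm.antidiagonal 3).over (w.1.adicCompletion L))).Adj vtx cx ∧ (latticeGraph (galAdicCompletionMap (L := L) (IsCMField.complexConj L) hw) ϖ ((StdForm.antidiagonal 3).over (w.1.adicCompletion L))).dist ⟨stdLattice (w.1.adicCompletion L) 3, 0, isSelfDualLattice_stdLattice_three_of_v hϖ⟩ cx = (latticeGraph (galAdicCompletionMap (L := L) (IsCMField.complexConj L) hw) ϖ ((StdForm.antidiagonal 3).over (w.1.adicCompletion L))).dist ⟨stdLattice (w.1.adicCompletion L) 3, 0, isSelfDualLattice_stdLattice_three_of_v hϖ⟩ vtx + 1 ∧ latticeGraphIso (galAdicCompletionMap (L := L) (IsCMField.complexConj L) hw) ϖ ((StdForm.antidiagonal 3).over (w.1.adicCompletion L)) γ' cx = cx) ∧ ((latticeGraph (galAdicCompletionMap (L := L) (IsCMField.complexConj L) hw) ϖ ((StdForm.antidiagonal 3).over (w.1.adicCompletion L))).Adj cx wtx ∧ (latticeGraph (galAdicCompletionMap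 (L := L) (IsCMField.complexConj L) hw) ϖ ((StdForm.antidiagonal 3).over (w.1.adicCompletion L))).dist ⟨stdLattice (w.1.adicCompletion L) 3, 0, isSelfDualLattice_stdLattice_three_of_v hϖ⟩ wtx = (latticeGraph (galAdicCompletionMap (L := L) (IsCMField.complexConj L) hw) ϖ ((StdForm.antidiagonal 3).over (w.1.adicCompletion L))).dist ⟨stdLattice (w.1.adicCompletion L) 3, 0, isSelfDualLattice_stdLattice_three_of_v hϖ⟩ cx + 1 ∧ latticeGraphIso (galAdicCompletionMap (L := L) (IsCMField.complexConj L) hw) ϖ ((StdForm.antidiagonal 3).over (w.1.adicCompletion L)) γ' wtx = wtx)} ∧ (¬ wtx.1.map ((Matrix.toLin' (((γ' : GL (Fin 3) (w.1.adicCompletion L)) : Matrix (Fin 3) (Fin 3) (w.1.adicCompletion L)) - 1)).restrictScalars (Valued.integer (w.1.adicCompletion L))) ≤ scaleLattice (ϖ ^ m) wtx.1 ∧ (wtx.1.map ((Matrix.toLin' (((γ' : GL (Fin 3) (w.1.adicCompletion L)) : Matrix (Fin 3) (Fin 3) (w.1.adicCompletion L)) - 1)).restrictScalars (Valued.integer (w.1.adicCompletion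 L))) ≤ scaleLattice (ϖ ^ (m - 2)) wtx.1 ∧ ¬ wtx.1.map ((Matrix.toLin' (((γ' : GL (Fin 3) (w.1.adicCompletion L)) : Matrix (Fin 3) (Fin 3) (w.1.adicCompletion L)) - 1)).restrictScalars (Valued.integer (w.1.adicCompletion L))) ≤ scaleLattice (ϖ ^ (m - 1)) wtx.1) ∧ ∃ y ∈ wtx.1, ∃ a : (w.1.adicCompletion L), Valued.v a = 1 ∧ Valued.v ((ϖ ^ (m - 2))⁻¹ * pairing (galAdicCompletionMap (L := L) (IsCMField.complexConj L) hw) ((StdForm.antidiagonal 3).over (w.1.adicCompletion L)) y ((((γ' : GL (Fin 3) (w.1.adicCompletion L)) : Matrix (Fin 3) (Fin 3) (w.1.adicCompletion L)) - 1) *ᵥ y) - (c) * a ^ 2) < 1)}).ncard : ℕ) : ℂ) + ((∑ vtx ∈ sR, ({wtx | wtx ∈ {wtx | ∃ cx, ((latticeGraph (galAdicCompletionMap (L := L) (IsCMField.complexConj L) hw) ϖ ((StdForm.antidiagonal 3).over (w.1.adicCompletion L))).Adj vtx cx ∧ (latticeGraph (galAdicCompletionMap (L := L) (IsCMField.complexConj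 L) hw) ϖ ((StdForm.antidiagonal 3).over (w.1.adicCompletion L))).dist ⟨stdLattice (w.1.adicCompletion L) 3, 0, isSelfDualLattice_stdLattice_three_of_v hϖ⟩ cx = (latticeGraph (galAdicCompletionMap (L := L) (IsCMField.complexConj L) hw) ϖ ((StdForm.antidiagonal 3).over (w.1.adicCompletion L))).dist ⟨stdLattice (w.1.adicCompletion L) 3, 0, isSelfDualLattice_stdLattice_three_of_v hϖ⟩ vtx + 1 ∧ latticeGraphIso (galAdicCompletionMap (L := L) (IsCMField.complexConj L) hw) ϖ ((StdForm.antidiagonal 3).over (w.1.adicCompletion L)) γ' cx = cx) ∧ ((latticeGraph (galAdicCompletionMap (L := L) (IsCMField.complexConj L) hw) ϖ ((StdForm.antidiagonal 3).over (w.1.adicCompletion L))).Adj cx wtx ∧ (latticeGraph (galAdicCompletionMap (L := L) (IsCMField.complexConj L) hw) ϖ ((StdForm.antidiagonal 3).over (w.1.adicCompletion L))).dist ⟨stdLattice (w.1.adicCompletion L) 3, 0, isSelfDualLattice_stdLattice_three_of_v hϖ⟩ wtx = (latticeGraph (galAdicCompletionMap (L := L) (IsCMField.complexConj L) hw) ϖ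 ((StdForm.antidiagonal 3).over (w.1.adicCompletion L))).dist ⟨stdLattice (w.1.adicCompletion L) 3, 0, isSelfDualLattice_stdLattice_three_of_v hϖ⟩ cx + 1 ∧ latticeGraphIso (galAdicCompletionMap (L := L) (IsCMField.complexConj L) hw) ϖ ((StdForm.antidiagonal 3).over (w.1.adicCompletion L)) γ' wtx = wtx)} ∧ (¬ wtx.1.map ((Matrix.toLin' (((γ' : GL (Fin 3) (w.1.adicCompletion L)) : Matrix (Fin 3) (Fin 3) (w.1.adicCompletion L)) - 1)).restrictScalars (Valued.integer (w.1.adicCompletion L))) ≤ scaleLattice (ϖ ^ m) wtx.1 ∧ (wtx.1.map ((Matrix.toLin' (((γ' : GL (Fin 3) (w.1.adicCompletion L)) : Matrix (Fin 3) (Fin 3) (w.1.adicCompletion L)) - 1)).restrictScalars (Valued.integer (w.1.adicCompletion L))) ≤ scaleLattice (ϖ ^ (m - 2)) wtx.1 ∧ ¬ wtx.1.map ((Matrix.toLin' (((γ' : GL (Fin 3) (w.1.adicCompletion L)) : Matrix (Fin 3) (Fin 3) (w.1.adicCompletion L)) - 1)).restrictScalars (Valued.integer (w.1.adicCompletion L)))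 ≤ scaleLattice (ϖ ^ (m - 1)) wtx.1) ∧ ¬ (∃ y ∈ wtx.1, ∃ a : (w.1.adicCompletion L), Valued.v a = 1 ∧ Valued.v ((ϖ ^ (m - 2))⁻¹ * pairing (galAdicCompletionMap (L := L) (IsCMField.complexConj L) hw) ((StdForm.antidiagonal 3).over (w.1.adicCompletion L)) y ((((γ' : GL (Fin 3) (w.1.adicCompletion L)) : Matrix (Fin 3) (Fin 3) (w.1.adicCompletion L)) - 1) *ᵥ y) - (c) * a ^ 2) < 1))}).ncard : ℕ) : ℂ) = ((Ideal.absNorm v.asIdeal : ℂ) - 1) * (Ideal.absNorm v.asIdeal : ℂ) * ((sR.card : ℕ) : ℂ) ∧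
    ((∃ z : (w.1.adicCompletion L), Valued.v z = 1 ∧ Valued.v (((((γH.1.val : GL (Fin 2) (UnitaryGroup.LocalRing L v)).val.map (Pi.evalRingHom (fun w' : PlacesOver L v => w'.1.adicCompletion L) w))).trace - 2 * finGammaTwo L v γH w) / (2 * ϖ ^ m) - c * z ^ 2) < 1) →
      ((∑ vtx ∈ sR, ({wtx | wtx ∈ {wtx | ∃ cx, ((latticeGraph (galAdicCompletionMap (L := L) (IsCMField.complexConj L) hw) ϖ ((StdForm.antidiagonal 3).over (w.1.adicCompletion L))).Adj vtx cx ∧ (latticeGraph (galAdicCompletionMap (L := L) (IsCMField.complexConj L) hw) ϖ ((StdForm.antidiagonal 3).over (w.1.adicCompletion L))).dist ⟨stdLattice (w.1.adicCompletion L) 3, 0, isSelfDualLattice_stdLattice_three_of_v hϖ⟩ cx = (latticeGraph (galAdicCompletionMap (L := L) (IsCMField.complexConj L) hw) ϖ ((StdForm.antidiagonal 3).over (w.1.adicCompletion L))).dist ⟨stdLattice (w.1.adicCompletion L) 3, 0, isSelfDualLattice_stdLattice_three_of_v hϖ⟩ vtx + 1 ∧ latticeGraphIso (galAdicCompletionMap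 (L := L) (IsCMField.complexConj L) hw) ϖ ((StdForm.antidiagonal 3).over (w.1.adicCompletion L)) γ' cx = cx) ∧ ((latticeGraph (galAdicCompletionMap (L := L) (IsCMField.complexConj L) hw) ϖ ((StdForm.antidiagonal 3).over (w.1.adicCompletion L))).Adj cx wtx ∧ (latticeGraph (galAdicCompletionMap (L := L) (IsCMField.complexConj L) hw) ϖ ((StdForm.antidiagonal 3).over (w.1.adicCompletion L))).dist ⟨stdLattice (w.1.adicCompletion L) 3, 0, isSelfDualLattice_stdLattice_three_of_v hϖ⟩ wtx = (latticeGraph (galAdicCompletionMap (L := L) (IsCMField.complexConj L) hw) ϖ ((StdForm.antidiagonal 3).over (w.1.adicCompletion L))).dist ⟨stdLattice (w.1.adicCompletion L) 3, 0, isSelfDualLattice_stdLattice_three_of_v hϖ⟩ cx + 1 ∧ latticeGraphIso (galAdicCompletionMap (L := L) (IsCMField.complexConj L) hw) ϖ ((StdForm.antidiagonal 3).over (w.1.adicCompletion L)) γ' wtx = wtx)} ∧ (¬ wtx.1.map ((Matrix.toLin' (((γ' : GL (Fin 3) (w.1.adicCompletion L)) : Matrix (Fin 3) (Fin 3) (w.1.adicCompletion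 L)) - 1)).restrictScalars (Valued.integer (w.1.adicCompletion L))) ≤ scaleLattice (ϖ ^ m) wtx.1 ∧ (wtx.1.map ((Matrix.toLin' (((γ' : GL (Fin 3) (w.1.adicCompletion L)) : Matrix (Fin 3) (Fin 3) (w.1.adicCompletion L)) - 1)).restrictScalars (Valued.integer (w.1.adicCompletion L))) ≤ scaleLattice (ϖ ^ (m - 2)) wtx.1 ∧ ¬ wtx.1.map ((Matrix.toLin' (((γ' : GL (Fin 3) (w.1.adicCompletion L)) : Matrix (Fin 3) (Fin 3) (w.1.adicCompletion L)) - 1)).restrictScalars (Valued.integer (w.1.adicCompletion L))) ≤ scaleLattice (ϖ ^ (m - 1)) wtx.1) ∧ ∃ y ∈ wtx.1, ∃ a : (w.1.adicCompletion L), Valued.v a = 1 ∧ Valued.v ((ϖ ^ (m - 2))⁻¹ * pairing (galAdicCompletionMap (L := L) (IsCMField.complexConj L) hw) ((StdForm.antidiagonal 3).over (w.1.adicCompletion L)) y ((((γ' : GL (Fin 3) (w.1.adicCompletion L)) : Matrix (Fin 3) (Fin 3) (w.1.adicCompletion L)) - 1) *ᵥ y) - (c) * a ^ 2) < 1)}).ncard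 : ℕ) : ℂ) - ((∑ vtx ∈ sR, ({wtx | wtx ∈ {wtx | ∃ cx, ((latticeGraph (galAdicCompletionMap (L := L) (IsCMField.complexConj L) hw) ϖ ((StdForm.antidiagonal 3).over (w.1.adicCompletion L))).Adj vtx cx ∧ (latticeGraph (galAdicCompletionMap (L := L) (IsCMField.complexConj L) hw) ϖ ((StdForm.antidiagonal 3).over (w.1.adicCompletion L))).dist ⟨stdLattice (w.1.adicCompletion L) 3, 0, isSelfDualLattice_stdLattice_three_of_v hϖ⟩ cx = (latticeGraph (galAdicCompletionMap (L := L) (IsCMField.complexConj L) hw) ϖ ((StdForm.antidiagonal 3).over (w.1.adicCompletion L))).dist ⟨stdLattice (w.1.adicCompletion L) 3, 0, isSelfDualLattice_stdLattice_three_of_v hϖ⟩ vtx + 1 ∧ latticeGraphIso (galAdicCompletionMap (L := L) (IsCMField.complexConj L) hw) ϖ ((StdForm.antidiagonal 3).over (w.1.adicCompletion L)) γ' cx = cx) ∧ ((latticeGraph (galAdicCompletionMap (L := L) (IsCMField.complexConj L) hw) ϖ ((StdForm.antidiagonal 3).over (w.1.adicCompletion L))).Adj cx wtx ∧ (latticeGraph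 (galAdicCompletionMap (L := L) (IsCMField.complexConj L) hw) ϖ ((StdForm.antidiagonal 3).over (w.1.adicCompletion L))).dist ⟨stdLattice (w.1.adicCompletion L) 3, 0, isSelfDualLattice_stdLattice_three_of_v hϖ⟩ wtx = (latticeGraph (galAdicCompletionMap (L := L) (IsCMField.complexConj L) hw) ϖ ((StdForm.antidiagonal 3).over (w.1.adicCompletion L))).dist ⟨stdLattice (w.1.adicCompletion L) 3, 0, isSelfDualLattice_stdLattice_three_of_v hϖ⟩ cx + 1 ∧ latticeGraphIso (galAdicCompletionMap (L := L) (IsCMField.complexConj L) hw) ϖ ((StdForm.antidiagonal 3).over (w.1.adicCompletion L)) γ' wtx = wtx)} ∧ (¬ wtx.1.map ((Matrix.toLin' (((γ' : GL (Fin 3) (w.1.adicCompletion L)) : Matrix (Fin 3) (Fin 3) (w.1.adicCompletion L)) - 1)).restrictScalars (Valued.integer (w.1.adicCompletion L))) ≤ scaleLattice (ϖ ^ m) wtx.1 ∧ (wtx.1.map ((Matrix.toLin' (((γ' : GL (Fin 3) (w.1.adicCompletion L)) : Matrix (Fin 3) (Fin 3) (w.1.adicCompletion L)) - 1)).restrictScalars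 (Valued.integer (w.1.adicCompletion L))) ≤ scaleLattice (ϖ ^ (m - 2)) wtx.1 ∧ ¬ wtx.1.map ((Matrix.toLin' (((γ' : GL (Fin 3) (w.1.adicCompletion L)) : Matrix (Fin 3) (Fin 3) (w.1.adicCompletion L)) - 1)).restrictScalars (Valued.integer (w.1.adicCompletion L))) ≤ scaleLattice (ϖ ^ (m - 1)) wtx.1) ∧ ¬ (∃ y ∈ wtx.1, ∃ a : (w.1.adicCompletion L), Valued.v a = 1 ∧ Valued.v ((ϖ ^ (m - 2))⁻¹ * pairing (galAdicCompletionMap (L := L) (IsCMField.complexConj L) hw) ((StdForm.antidiagonal 3).over (w.1.adicCompletion L)) y ((((γ' : GL (Fin 3) (w.1.adicCompletion L)) : Matrix (Fin 3) (Fin 3) (w.1.adicCompletion L)) - 1) *ᵥ y) - (c) * a ^ 2) < 1))}).ncard : ℕ) : ℂ) = -(((Ideal.absNorm v.asIdeal : ℂ) + 1) * (Ideal.absNorm v.asIdeal : ℂ))) ∧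
    (¬ (∃ z : (w.1.adicCompletion L), Valued.v z = 1 ∧ Valued.v (((((γH.1.val : GL (Fin 2) (UnitaryGroup.LocalRing L v)).val.map (Pi.evalRingHom (fun w' : PlacesOver L v => w'.1.adicCompletion L) w))).trace - 2 * finGammaTwo L v γH w) / (2 * ϖ ^ m) - c * z ^ 2) < 1) →
      ((∑ vtx ∈ sR, ({wtx | wtx ∈ {wtx | ∃ cx, ((latticeGraph (galAdicCompletionMap (L := L) (IsCMField.complexConj L) hw) ϖ ((StdForm.antidiagonal 3).over (w.1.adicCompletion L))).Adj vtx cx ∧ (latticeGraph (galAdicCompletionMap (L := L) (IsCMField.complexConj L) hw) ϖ ((StdForm.antidiagonal 3).over (w.1.adicCompletion L))).dist ⟨stdLattice (w.1.adicCompletion L) 3, 0, isSelfDualLattice_stdLattice_three_of_v hϖ⟩ cx = (latticeGraph (galAdicCompletionMap (L := L) (IsCMField.complexConj L) hw) ϖ ((StdForm.antidiagonal 3).over (w.1.adicCompletion L))).dist ⟨stdLattice (w.1.adicCompletion L) 3, 0, isSelfDualLattice_stdLattice_three_of_v hϖ⟩ vtx + 1 ∧ latticeGraphIso (galAdicCompletionMap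 (L := L) (IsCMField.complexConj L) hw) ϖ ((StdForm.antidiagonal 3).over (w.1.adicCompletion L)) γ' cx = cx) ∧ ((latticeGraph (galAdicCompletionMap (L := L) (IsCMField.complexConj L) hw) ϖ ((StdForm.antidiagonal 3).over (w.1.adicCompletion L))).Adj cx wtx ∧ (latticeGraph (galAdicCompletionMap (L := L) (IsCMField.complexConj L) hw) ϖ ((StdForm.antidiagonal 3).over (w.1.adicCompletion L))).dist ⟨stdLattice (w.1.adicCompletion L) 3, 0, isSelfDualLattice_stdLattice_three_of_v hϖ⟩ wtx = (latticeGraph (galAdicCompletionMap (L := L) (IsCMField.complexConj L) hw) ϖ ((StdForm.antidiagonal 3).over (w.1.adicCompletion L))).dist ⟨stdLattice (w.1.adicCompletion L) 3, 0, isSelfDualLattice_stdLattice_three_of_v hϖ⟩ cx + 1 ∧ latticeGraphIso (galAdicCompletionMap (L := L) (IsCMField.complexConj L) hw) ϖ ((StdForm.antidiagonal 3).over (w.1.adicCompletion L)) γ' wtx = wtx)} ∧ (¬ wtx.1.map ((Matrix.toLin' (((γ' : GL (Fin 3) (w.1.adicCompletion L)) : Matrix (Fin 3) (Fin 3) (w.1.adicCompletion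 L)) - 1)).restrictScalars (Valued.integer (w.1.adicCompletion L))) ≤ scaleLattice (ϖ ^ m) wtx.1 ∧ (wtx.1.map ((Matrix.toLin' (((γ' : GL (Fin 3) (w.1.adicCompletion L)) : Matrix (Fin 3) (Fin 3) (w.1.adicCompletion L)) - 1)).restrictScalars (Valued.integer (w.1.adicCompletion L))) ≤ scaleLattice (ϖ ^ (m - 2)) wtx.1 ∧ ¬ wtx.1.map ((Matrix.toLin' (((γ' : GL (Fin 3) (w.1.adicCompletion L)) : Matrix (Fin 3) (Fin 3) (w.1.adicCompletion L)) - 1)).restrictScalars (Valued.integer (w.1.adicCompletion L))) ≤ scaleLattice (ϖ ^ (m - 1)) wtx.1) ∧ ∃ y ∈ wtx.1, ∃ a : (w.1.adicCompletion L), Valued.v a = 1 ∧ Valued.v ((ϖ ^ (m - 2))⁻¹ * pairing (galAdicCompletionMap (L := L) (IsCMField.complexConj L) hw) ((StdForm.antidiagonal 3).over (w.1.adicCompletion L)) y ((((γ' : GL (Fin 3) (w.1.adicCompletion L)) : Matrix (Fin 3) (Fin 3) (w.1.adicCompletion L)) - 1) *ᵥ y) - (c) * a ^ 2) < 1)}).ncard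 : ℕ) : ℂ) - ((∑ vtx ∈ sR, ({wtx | wtx ∈ {wtx | ∃ cx, ((latticeGraph (galAdicCompletionMap (L := L) (IsCMField.complexConj L) hw) ϖ ((StdForm.antidiagonal 3).over (w.1.adicCompletion L))).Adj vtx cx ∧ (latticeGraph (galAdicCompletionMap (L := L) (IsCMField.complexConj L) hw) ϖ ((StdForm.antidiagonal 3).over (w.1.adicCompletion L))).dist ⟨stdLattice (w.1.adicCompletion L) 3, 0, isSelfDualLattice_stdLattice_three_of_v hϖ⟩ cx = (latticeGraph (galAdicCompletionMap (L := L) (IsCMField.complexConj L) hw) ϖ ((StdForm.antidiagonal 3).over (w.1.adicCompletion L))).dist ⟨stdLattice (w.1.adicCompletion L) 3, 0, isSelfDualLattice_stdLattice_three_of_v hϖ⟩ vtx + 1 ∧ latticeGraphIso (galAdicCompletionMap (L := L) (IsCMField.complexConj L) hw) ϖ ((StdForm.antidiagonal 3).over (w.1.adicCompletion L)) γ' cx = cx) ∧ ((latticeGraph (galAdicCompletionMap (L := L) (IsCMField.complexConj L) hw) ϖ ((StdForm.antidiagonal 3).over (w.1.adicCompletion L))).Adj cx wtx ∧ (latticeGraph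 (galAdicCompletionMap (L := L) (IsCMField.complexConj L) hw) ϖ ((StdForm.antidiagonal 3).over (w.1.adicCompletion L))).dist ⟨stdLattice (w.1.adicCompletion L) 3, 0, isSelfDualLattice_stdLattice_three_of_v hϖ⟩ wtx = (latticeGraph (galAdicCompletionMap (L := L) (IsCMField.complexConj L) hw) ϖ ((StdForm.antidiagonal 3).over (w.1.adicCompletion L))).dist ⟨stdLattice (w.1.adicCompletion L) 3, 0, isSelfDualLattice_stdLattice_three_of_v hϖ⟩ cx + 1 ∧ latticeGraphIso (galAdicCompletionMap (L := L) (IsCMField.complexConj L) hw) ϖ ((StdForm.antidiagonal 3).over (w.1.adicCompletion L)) γ' wtx = wtx)} ∧ (¬ wtx.1.map ((Matrix.toLin' (((γ' : GL (Fin 3) (w.1.adicCompletion L)) : Matrix (Fin 3) (Fin 3) (w.1.adicCompletion L)) - 1)).restrictScalars (Valued.integer (w.1.adicCompletion L))) ≤ scaleLattice (ϖ ^ m) wtx.1 ∧ (wtx.1.map ((Matrix.toLin' (((γ' : GL (Fin 3) (w.1.adicCompletion L)) : Matrix (Fin 3) (Fin 3) (w.1.adicCompletion L)) - 1)).restrictScalars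 (Valued.integer (w.1.adicCompletion L))) ≤ scaleLattice (ϖ ^ (m - 2)) wtx.1 ∧ ¬ wtx.1.map ((Matrix.toLin' (((γ' : GL (Fin 3) (w.1.adicCompletion L)) : Matrix (Fin 3) (Fin 3) (w.1.adicCompletion L)) - 1)).restrictScalars (Valued.integer (w.1.adicCompletion L))) ≤ scaleLattice (ϖ ^ (m - 1)) wtx.1) ∧ ¬ (∃ y ∈ wtx.1, ∃ a : (w.1.adicCompletion L), Valued.v a = 1 ∧ Valued.v ((ϖ ^ (m - 2))⁻¹ * pairing (galAdicCompletionMap (L := L) (IsCMField.complexConj L) hw) ((StdForm.antidiagonal 3).over (w.1.adicCompletion L)) y ((((γ' : GL (Fin 3) (w.1.adicCompletion L)) : Matrix (Fin 3) (Fin 3) (w.1.adicCompletion L)) - 1) *ᵥ y) - (c) * a ^ 2) < 1))}).ncard : ℕ) : ℂ) = ((Ideal.absNorm v.asIdeal : ℂ) + 1) * (Ideal.absNorm v.asIdeal : ℂ)) := by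
  classical
  -- THE CM DRESS ⟶ the generic tame-ramified hypotheses (★ p849335 ∕ ★ p849540 pattern)
  have hc1 : IsCMField.complexConj L ≠ 1 := IsCMField.complexConj_ne_one L
  have h2v : Valued.v (2 : (w.1.adicCompletion L)) = 1 := (isUnit_two_integer_iff_valued_eq_one L w.1).1 h2
  have hσσ : ∀ z : (w.1.adicCompletion L), (galAdicCompletionMap (L := L) (IsCMField.complexConj L) hw) ((galAdicCompletionMap (L := L) (IsCMField.complexConj L) hw) z) = z :=
    galAdicCompletionMap_galAdicCompletionMap_of_smul_eq (IsCMField.complexConj L) w hc1 hw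
  have hvσ : ∀ z : (w.1.adicCompletion L), Valued.v ((galAdicCompletionMap (L := L) (IsCMField.complexConj L) hw) z) = Valued.v z := fun z =>
    valued_galAdicCompletionMap (L := L) (IsCMField.complexConj L) hw z
  obtain ⟨-, -, -, hres, hnorm⟩ := ramifiedBlock_adicCompletion L v w hw he h2v
  haveI : Fintype (Valued.ResidueField (w.1.adicCompletion L)) := Fintype.ofFinite _
  haveI := isPrincipalIdealRing_integer_adicCompletion L v w
  have hT := isTree_latticeGraph_three_of_neg hσσ hvσ hϖ hσϖ hres h2v hnorm
  have hϖ0 : ϖ ≠ 0 := fun h0 => by rw [h0, map_zero] at hϖ; exact WithZero.coe_ne_zero hϖ.symm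
  have hvϖ0 : Valued.v ϖ ≠ 0 := (Valuation.ne_zero_iff _).2 hϖ0
  have hϖlt : Valued.v ϖ < 1 := by rw [hϖ, ← WithZero.exp_zero]; exact WithZero.exp_lt_exp.2 (by norm_num)
  have hpow : ∀ j : ℕ, Valued.v ϖ ^ j = WithZero.exp (-(j : ℤ)) := by
    intro j
    induction j with
    | zero => rw [pow_zero, Nat.cast_zero, neg_zero, WithZero.exp_zero]
    | succ j ih => rw [pow_succ, ih, hϖ, ← WithZero.exp_add]; congr 1; push_cast; ring
  -- `q`: the residue field of `L_w` has `N𝔭_v` elements, an odd number `2h + 3`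
  have hqN : Fintype.card (Valued.ResidueField (w.1.adicCompletion L)) = Nat.card (𝓞 ↥(maximalRealSubfield L) ⧸ v.asIdeal) := by
    rw [Fintype.card_eq_nat_card, ← natCard_residueField_eq_of_compatible, natCard_residueField_eq_of_ramified (IsCMField.complexConj L) v hc1 w hw he]
  -- the generic binders of ★ (K4c) at `γ′ = ι(B₀, 1)`
  have hd3 : 3 ≤ m := by omega
  have hoddm : Odd m := ⟨mA + 1, by omega⟩
  have hsv : Valued.v (s : (w.1.adicCompletion L)) = 1 := by
    have hh' := congrArg Valued.v hs
    rwa [map_mul, v_oneByOne_eq_one_of_local L w hw γH.2, mul_one, map_one] at hh'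
  have hchar : ((γ' : GL (Fin 3) (w.1.adicCompletion L)) : Matrix (Fin 3) (Fin 3) (w.1.adicCompletion L)).charpoly = (X - C 1) * ((((k⁻¹ * (Matrix.GeneralLinearGroup.scalar (Fin 2) s * ((localNonsplitEquiv (IsCMField.complexConj L) (Matrix.of fun i j : Fin 2 => if i.val + j.val + 1 = 2 then (1 : L) else 0) (IsCMField.complexConj_ne_one L) w hw γH.1).val : GL (Fin 2) (w.1.adicCompletion L))) * k) : GL (Fin 2) (w.1.adicCompletion L)) : Matrix (Fin 2) (Fin 2) (w.1.adicCompletion L))).charpoly := by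
    rw [hγ']; exact charpoly_coe_endoGL_one _
  have hdiscB : Valued.v (((((k⁻¹ * (Matrix.GeneralLinearGroup.scalar (Fin 2) s * ((localNonsplitEquiv (IsCMField.complexConj L) (Matrix.of fun i j : Fin 2 => if i.val + j.val + 1 = 2 then (1 : L) else 0) (IsCMField.complexConj_ne_one L) w hw γH.1).val : GL (Fin 2) (w.1.adicCompletion L))) * k) : GL (Fin 2) (w.1.adicCompletion L)) : Matrix (Fin 2) (Fin 2) (w.1.adicCompletion L))).trace ^ 2 - 4 * ((((k⁻¹ * (Matrix.GeneralLinearGroup.scalar (Fin 2) s * ((localNonsplitEquiv (IsCMField.complexConj L) (Matrix.of fun i j : Fin 2 => if i.val + j.val + 1 = 2 then (1 : L) else 0) (IsCMField.complexConj_ne_one L) w hw γH.1).val : GL (Fin 2) (w.1.adicCompletion L))) * k) : GL (Fin 2) (w.1.adicCompletion L)) : Matrix (Fin 2) (Fin 2) (w.1.adicCompletion L))).det) < Valued.v ϖ ^ (2 * m) := by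
    rw [v_disc_rerootedCentred_ram L w hw γH s hs k, hdisc, hpow]
    exact WithZero.exp_lt_exp.2 (by push_cast; omega)
  obtain ⟨-, hB, -⟩ := typeTwo_depthDictionary_odd_ram L w hw he h2 ϖ hϖ hσϖ hblk hu2 hirr hdisc m hm β hβ
  have hsc := (hB hlt).2.2.2
  have hcB : Valued.v (((((k⁻¹ * (Matrix.GeneralLinearGroup.scalar (Fin 2) s * ((localNonsplitEquiv (IsCMField.complexConj L) (Matrix.of fun i j : Fin 2 => if i.val + j.val + 1 = 2 then (1 : L) else 0) (IsCMField.complexConj_ne_one L) w hw γH.1).val : GL (Fin 2) (w.1.adicCompletion L))) * k) : GL (Fin 2) (w.1.adicCompletion L)) : Matrix (Fin 2) (Fin 2) (w.1.adicCompletion L))).trace / 2 - 1) = Valued.v ϖ ^ m := by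
    rw [trace_coe_inv_conj_scalar_mul, mul_div_assoc, v_mul_trace_div_two_sub_one_eq h2v hs hsv, coe_localNonsplitEquiv_apply, ← map_pow]
    exact hsc
  -- the lock bridge ★ (K4d): `Λ(c)` of the socket ⟺ the lock at `B₀`
  have htr : ((((k⁻¹ * (Matrix.GeneralLinearGroup.scalar (Fin 2) s * ((localNonsplitEquiv (IsCMField.complexConj L) (Matrix.of fun i j : Fin 2 => if i.val + j.val + 1 = 2 then (1 : L) else 0) (IsCMField.complexConj_ne_one L) w hw γH.1).val : GL (Fin 2) (w.1.adicCompletion L))) * k) : GL (Fin 2) (w.1.adicCompletion L)) : Matrix (Fin 2) (Fin 2) (w.1.adicCompletion L))).trace = (s : (w.1.adicCompletion L)) * ((((γH.1.val : GL (Fin 2) (UnitaryGroup.LocalRing L v)).val.map (Pi.evalRingHom (fun w' : PlacesOver L v => w'.1.adicCompletion L) w)))).trace := by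
    rw [trace_coe_inv_conj_scalar_mul, coe_localNonsplitEquiv_apply]
  have hs' : (s : (w.1.adicCompletion L)) * finGammaTwo L v γH w = 1 := hs
  have hu1 : Valued.v (finGammaTwo L v γH w - 1) < 1 :=
    hu2.trans_lt (by rw [map_pow]; exact pow_lt_one₀ zero_le hϖlt two_ne_zero)
  have hY : Valued.v ((((((γH.1.val : GL (Fin 2) (UnitaryGroup.LocalRing L v)).val.map (Pi.evalRingHom (fun w' : PlacesOver L v => w'.1.adicCompletion L) w)))).trace - 2 * finGammaTwo L v γH w) / (2 * ϖ ^ m)) ≤ 1 := by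
    rw [map_div₀, map_mul, h2v, one_mul, show ((((γH.1.val : GL (Fin 2) (UnitaryGroup.LocalRing L v)).val.map (Pi.evalRingHom (fun w' : PlacesOver L v => w'.1.adicCompletion L) w)))).trace - 2 * finGammaTwo L v γH w = -(2 * finGammaTwo L v γH w - ((((γH.1.val : GL (Fin 2) (UnitaryGroup.LocalRing L v)).val.map (Pi.evalRingHom (fun w' : PlacesOver L v => w'.1.adicCompletion L) w)))).trace) by ring,
      Valuation.map_neg, hsc]
    exact (div_self (by rw [map_pow]; exact pow_ne_zero _ hvϖ0)).le
  have hbridge := lock_iff_of_trace_eq_mul hϖ h2v htr hs' hu1 hY c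
  -- the kind counts ★ (K5-B-J) (F0P3a-p08 (g21))
  have hN0 := ncard_rootRegion_inner_hyperbolic_of_odd_B_ram L w hw he h2 ϖ hϖ hσϖ γH hblk hu2 hirr hdisc m hm β hβ s hs k hk γ' hγ' mA a hmA hna hlt
  have hN1 := ncard_rootRegion_shellSmall_hyperbolic_of_odd_B_ram L w hw he h2 ϖ hϖ hσϖ γH hblk hu2 hirr hdisc m hm β hβ s hs k hk γ' hγ' mA a hmA hna hlt ε hεv hε
  have hN2 := ncard_rootRegion_shellBig_hyperbolic_of_odd_B_ram L w hw he h2 ϖ hϖ hσϖ γH hblk hu2 hirr hdisc m hm β hβ s hs k hk γ' hγ' mA a hmA hna hlt ε hεv hε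
  -- ★ (K4e) the closed-form census (generic) at `γ′`, and the lock bridge
  have hQ : ((Nat.card (𝓞 ↥(maximalRealSubfield L) ⧸ v.asIdeal) : ℕ) : ℂ) = (Ideal.absNorm v.asIdeal : ℂ) := by
    rw [Ideal.absNorm_apply, Submodule.cardQuot_apply]
  obtain ⟨h1, h2', h3, h4, h5⟩ := regionCensus_hyperbolic_closedForm_odd hσσ hvσ hσϖ hϖ hres h2v hnorm hT _ hγ' hd3 hoddm
    (fun vtx e hle hlev => map_sub_one_pow_three_le_scaleLattice_of_charpoly_block_antidiagonal hϖ hchar (d := e) (by rw [sub_self, map_zero]; exact zero_le)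
        (fun i j => (hd i j).trans (pow_le_pow_right_of_le_one' hϖlt.le hle)) vtx hlev) hd hdiscB hcB c ε hc hεv hε sR hsR
    (Nat.card (𝓞 ↥(maximalRealSubfield L) ⧸ v.asIdeal)) hqN a hN0 hN1 hN2 (Ideal.absNorm v.asIdeal : ℂ) hQ
  exact ⟨h1, h2', h3, fun hl => h4 (hbridge.2 hl), fun hn => h5 (fun hl => hn (hbridge.1 hl))⟩

end Literature.NumberTheory.Rogawski1990.BlockLawHyp

end
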